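import Mathlib.Analysis.InnerProductSpace.PiL2
import Mathlib.Topology.Order.IntermediateValue

/-!
# The `(2n+1)`-point family of spherical codes: `A(n, arccos mₙ) ≥ 2n + 1` for every `n ≥ 2`

Framing: lottery ticket; floor = certified bounds/negative ranges. Venture `PackingBounds` (cell
`pub-packcert`, seat `pub-packcert-recog`, T5-ATTAINED (ii) (A)) — an attained-side structure read off the
recognition seat's registered numerical sweep (RECOG-TABLE §T5-ATTAINED-SWEEP (ii) (A)) and proved here for ALL
dimensions at once.  No optimality is claimed.

For `n ≥ 2` let `m ∈ (0, 1/n)` solve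
`(★)  √(1−m) · √(n(1−m²)/(n−1)) = m · (n + √n · √(1+(n−1)m))`;
such an `m` exists by the intermediate value theorem (`exists_root`), and squaring `(★)` twice shows that
`m` is a root of the quartic `Gₙ(x) = n²(n−2)² x⁴ − 4n(n−1) x³ − 2n² x² + 1` (`quartic_eq_zero_of_params`; the
identity used is `L² − 4n(n−1)² m⁴ (1+(n−1)m) = (1−m)² Gₙ(m)` with
`L = (1−m)(1−m²) − (n−1)m²(n+1+(n−1)m)`).  With `u = √(1−m)`, `v = √(1+(n−1)m)`, `r = √n`,
`s = √(n(1−m²)/(n−1))` the `2n+1` unit vectors of `ℝⁿ`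
`aᵢ = u eᵢ − ((u+v)/n) 𝟙`, `bᵢ = −s eᵢ + (m/r + s/n) 𝟙` (`i < n`), `z = (1/r) 𝟙`
have inner products `⟪aᵢ,aⱼ⟫ = ⟪z,bᵢ⟫ = ⟪aᵢ,bⱼ⟫ = m` (`i ≠ j`), `⟪bᵢ,bⱼ⟫ = m² − (1−m²)/(n−1) ≤ m`,
`⟪z,aᵢ⟫ = −v/r < 0`, `⟪aᵢ,bᵢ⟫ = m − u s < m` (`vec_props`), hence
**`exists_code_card_two_mul_add_one`: for every `n ≥ 2` there is `m ∈ (0, 1/n)` with `Gₙ(m) = 0` and a set of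
`2n+1` unit vectors of `ℝⁿ` with pairwise inner products `≤ m`**, i.e. `A(n, arccos m) ≥ 2n+1`.

Members of the family: `n = 2` the regular pentagon (`G₂(cos 72°) = 0`), `n = 3` the Schütte–van der Waerden
seven-point configuration (Tammes `N = 7`, `m₃ = 0.21013…`, `77.87°`), `n = 4, 5` the putative optima of the
Hardin–Smith–Sloane tables for `(4, 9)` and `(5, 11)`, `n = 6 … 10` the best configurations found by the seat's
pre-registered numerical search for `N = 2n+1` (to every printed digit).  Whether the family is in print for
general `n` is not known to us (literature legs: not located); optimality for `n ≥ 4` is open.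

## References
* K. Schütte, B. L. van der Waerden, Math. Ann. 123 (1951) 96–124 (Tammes `N = 7`, the member `n = 3`).
  [`SchutteVanderwaerden1951`]
* N. J. A. Sloane, with R. H. Hardin, W. D. Smith and others, *Tables of Spherical Codes* (putative optima
  for `(4, 9)`, `(5, 11)`).  [`HardinSloaneSmithSphericalCodes`]
-/

namespace Summit.Ventures.PackingBounds.Config.OddFamily

open Real WithLp Finset

/-- The quartic `Gₙ(m) = n²(n−2)² m⁴ − 4n(n−1) m³ − 2n² m² + 1`. -/
def quartic (n : ℕ) (m : ℝ) : ℝ :=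
  (n : ℝ) ^ 2 * ((n : ℝ) - 2) ^ 2 * m ^ 4 - 4 * (n : ℝ) * ((n : ℝ) - 1) * m ^ 3
    - 2 * (n : ℝ) ^ 2 * m ^ 2 + 1

/-- The defining function `Φₙ(m) = √(1−m)·√(n(1−m²)/(n−1)) − m (n + √n·√(1+(n−1)m))`; equation `(★)` is
`Φₙ(m) = 0`. -/
noncomputable def phi (n : ℕ) (m : ℝ) : ℝ :=
  sqrt (1 - m) * sqrt ((n : ℝ) * (1 - m ^ 2) / ((n : ℝ) - 1))
    - m * ((n : ℝ) + sqrt (n : ℝ) * sqrt (1 + ((n : ℝ) - 1) * m))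

/-- `Φₙ` is continuous. -/
theorem continuous_phi (n : ℕ) : Continuous (phi n) := by
  unfold phi
  fun_prop

/-- `Φₙ(0) > 0` for `n ≥ 2` (it equals `√(n/(n−1))`). -/
theorem phi_zero_pos (n : ℕ) (hn : 2 ≤ n) : 0 < phi n 0 := by
  have hN : (2 : ℝ) ≤ n := by exact_mod_cast hn
  have h1 : (0 : ℝ) < 1 - 0 := by norm_num
  have h2 : (0 : ℝ) < (n : ℝ) * (1 - 0 ^ 2) / ((n : ℝ) - 1) :=
    div_pos (mul_pos (by linarith) (by norm_num)) (by linarith)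
  show 0 < sqrt (1 - 0) * sqrt ((n : ℝ) * (1 - 0 ^ 2) / ((n : ℝ) - 1))
    - 0 * ((n : ℝ) + sqrt (n : ℝ) * sqrt (1 + ((n : ℝ) - 1) * 0))
  rw [zero_mul, sub_zero]
  exact mul_pos (sqrt_pos.2 h1) (sqrt_pos.2 h2)

/-- `Φₙ(1/n) < 0` for `n ≥ 2`: by `2ab ≤ a² + b²` the first product is `≤ 1`, while the second term is
`1 + (positive)`. -/
theorem phi_inv_neg (n : ℕ) (hn : 2 ≤ n) : phi n (1 / n) < 0 := by
  have hN : (2 : ℝ) ≤ n := by exact_mod_cast hn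
  have hN0 : (0 : ℝ) < n := by linarith
  have hN1 : (0 : ℝ) < (n : ℝ) - 1 := by linarith
  have q1 : 1 / (n : ℝ) ≤ 1 := by rw [div_le_one hN0]; linarith
  have q0 : 0 < 1 / (n : ℝ) := by positivity
  unfold phi
  set a := sqrt (1 - 1 / (n : ℝ)) with ha
  set b := sqrt ((n : ℝ) * (1 - (1 / (n : ℝ)) ^ 2) / ((n : ℝ) - 1)) with hb
  set c := sqrt (n : ℝ) * sqrt (1 + ((n : ℝ) - 1) * (1 / (n : ℝ))) with hc
  have ha2 : a ^ 2 = 1 - 1 / n := by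
    rw [ha, sq_sqrt]
    linarith
  have hb2 : b ^ 2 = 1 + 1 / n := by
    rw [hb, sq_sqrt]
    · field_simp
      ring
    · exact div_nonneg (mul_nonneg hN0.le (by nlinarith)) hN1.le
  have hab : a * b ≤ 1 := by nlinarith [sq_nonneg (a - b)]
  have hcpos : 0 < c := by
    rw [hc]
    exact mul_pos (sqrt_pos.2 hN0) (sqrt_pos.2 (by nlinarith))
  have h2 : 1 / (n : ℝ) * (n + c) = 1 + c / n := by
    rw [div_mul_eq_mul_div, one_mul, add_div, div_self hN0.ne']
  rw [h2]
  have : 0 < c / n := div_pos hcpos hN0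
  linarith

/-- **A solution of `(★)` exists in `(0, 1/n)`** (intermediate value theorem on `[0, 1/n]`). -/
theorem exists_root (n : ℕ) (hn : 2 ≤ n) : ∃ m : ℝ, 0 < m ∧ m < 1 / n ∧ phi n m = 0 := by
  have hN : (2 : ℝ) ≤ n := by exact_mod_cast hn
  have hlt : (0 : ℝ) < 1 / n := by positivity
  obtain ⟨m, ⟨hm0, hm1⟩, hm⟩ :=
    intermediate_value_Ioo' hlt.le (continuous_phi n).continuousOn ⟨phi_inv_neg n hn, phi_zero_pos n hn⟩
  exact ⟨m, hm0, hm1, hm⟩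

/-- **`(★)` implies `Gₙ(m) = 0`.**  Radical-free form: `u² = 1 − m`, `v² = 1 + (n−1)m`, `r² = n`,
`s² = n(1−m²)/(n−1)`, `m < 1`, and `(★)` reads `u s = m (n + r v)`. -/
theorem quartic_eq_zero_of_params (n : ℕ) (hn : 2 ≤ n) (m u v r s : ℝ) (hm1 : m < 1)
    (hu2 : u ^ 2 = 1 - m) (hv2 : v ^ 2 = 1 + ((n : ℝ) - 1) * m) (hr2 : r ^ 2 = n)
    (hs2 : s ^ 2 = (n : ℝ) * (1 - m ^ 2) / ((n : ℝ) - 1)) (hdef : u * s = m * (n + r * v)) :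
    quartic n m = 0 := by
  have hN : (2 : ℝ) ≤ n := by exact_mod_cast hn
  have hN0 : (n : ℝ) ≠ 0 := by positivity
  have hN1 : ((n : ℝ) - 1) ≠ 0 := by
    have : (0 : ℝ) < (n : ℝ) - 1 := by linarith
    exact this.ne'
  have hs2' : ((n : ℝ) - 1) * s ^ 2 = (n : ℝ) * (1 - m ^ 2) := by
    rw [hs2]
    field_simp
  have e1 : (u * s) ^ 2 = (m * ((n : ℝ) + r * v)) ^ 2 := by rw [hdef]
  have e2 : (1 - m) * ((n : ℝ) * (1 - m ^ 2))
      = ((n : ℝ) - 1) * m ^ 2 * ((n : ℝ) ^ 2 + 2 * (n : ℝ) * (r * v) + (n : ℝ) * v ^ 2) := by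
    linear_combination ((n : ℝ) - 1) * e1 - (1 - m) * hs2' - ((n : ℝ) - 1) * s ^ 2 * hu2
      + ((n : ℝ) - 1) * m ^ 2 * v ^ 2 * hr2
  have e3a : (n : ℝ) * ((1 - m) * (1 - m ^ 2)
      - ((n : ℝ) - 1) * m ^ 2 * ((n : ℝ) + 2 * (r * v) + v ^ 2)) = 0 := by
    linear_combination e2
  have e3b : (1 - m) * (1 - m ^ 2) - ((n : ℝ) - 1) * m ^ 2 * ((n : ℝ) + 2 * (r * v) + v ^ 2) = 0 :=
    (mul_eq_zero.1 e3a).resolve_left hN0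
  have e3 : (1 - m) * (1 - m ^ 2) - ((n : ℝ) - 1) * m ^ 2 * ((n : ℝ) + 1 + ((n : ℝ) - 1) * m)
      = 2 * ((n : ℝ) - 1) * m ^ 2 * (r * v) := by
    linear_combination e3b + ((n : ℝ) - 1) * m ^ 2 * hv2
  have e4 : ((1 - m) * (1 - m ^ 2) - ((n : ℝ) - 1) * m ^ 2 * ((n : ℝ) + 1 + ((n : ℝ) - 1) * m)) ^ 2
      - 4 * (n : ℝ) * ((n : ℝ) - 1) ^ 2 * m ^ 4 * (1 + ((n : ℝ) - 1) * m) = 0 := by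
    linear_combination
      ((1 - m) * (1 - m ^ 2) - ((n : ℝ) - 1) * m ^ 2 * ((n : ℝ) + 1 + ((n : ℝ) - 1) * m)
        + 2 * ((n : ℝ) - 1) * m ^ 2 * (r * v)) * e3
      + (4 * ((n : ℝ) - 1) ^ 2 * m ^ 4 * v ^ 2) * hr2 + (4 * ((n : ℝ) - 1) ^ 2 * m ^ 4 * (n : ℝ)) * hv2
  have e5 : (1 - m) ^ 2 * quartic n m = 0 := by
    unfold quartic
    linear_combination e4
  have hm : (1 - m) ^ 2 ≠ 0 := pow_ne_zero 2 (sub_ne_zero.2 hm1.ne')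
  exact (mul_eq_zero.1 e5).resolve_left hm

/-- Sum formula: `∑ₖ (a[k=i] + c)(b[k=j] + d) = ab[i=j] + ad + cb + n cd`. -/
theorem sum_pt_pt (n : ℕ) (i j : Fin n) (a b c d : ℝ) :
    ∑ k : Fin n, ((if k = i then a else 0) + c) * ((if k = j then b else 0) + d)
      = (if i = j then a * b else 0) + a * d + c * b + n * (c * d) := by
  have h : ∀ k : Fin n, ((if k = i then a else 0) + c) * ((if k = j then b else 0) + d)
      = (if k = i then (if i = j then a * b else 0) + a * d else 0)
        + (if k = j then c * b else 0) + c * d := by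
    intro k
    split_ifs <;> first | ring1 | (subst_vars; simp_all)
  simp_rw [h]
  rw [sum_add_distrib, sum_add_distrib, sum_ite_eq', sum_ite_eq']
  simp only [mem_univ, if_true, sum_const, card_univ, Fintype.card_fin, nsmul_eq_mul]

/-- Sum formula: `∑ₖ (a[k=i] + c) d = ad + n cd`. -/
theorem sum_pt_const (n : ℕ) (i : Fin n) (a c d : ℝ) :
    ∑ k : Fin n, ((if k = i then a else 0) + c) * d = a * d + n * (c * d) := by
  have h : ∀ k : Fin n, ((if k = i then a else 0) + c) * d = (if k = i then a * d else 0) + c * d := by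
    intro k
    split_ifs <;> ring1
  simp_rw [h]
  rw [sum_add_distrib, sum_ite_eq']
  simp only [mem_univ, if_true, sum_const, card_univ, Fintype.card_fin, nsmul_eq_mul]

/-- Sum formula: `∑ₖ d (a[k=i] + c) = da + n dc`. -/
theorem sum_const_pt (n : ℕ) (i : Fin n) (a c d : ℝ) :
    ∑ k : Fin n, d * ((if k = i then a else 0) + c) = d * a + n * (d * c) := by
  have h : ∀ k : Fin n, d * ((if k = i then a else 0) + c) = (if k = i then d * a else 0) + d * c := by
    intro k
    split_ifs <;> ring1
  simp_rw [h]
  rw [sum_add_distrib, sum_ite_eq']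
  simp only [mem_univ, if_true, sum_const, card_univ, Fintype.card_fin, nsmul_eq_mul]

/-- Sum formula: `∑ₖ c d = n cd`. -/
theorem sum_const_const (n : ℕ) (c d : ℝ) : ∑ _k : Fin n, c * d = n * (c * d) := by
  simp only [sum_const, card_univ, Fintype.card_fin, nsmul_eq_mul]

/-- A vector of `ℝⁿ` with `⟪x, x⟫ = 1` is a unit vector. -/
theorem norm_eq_one_of_inner (n : ℕ) (x : EuclideanSpace ℝ (Fin n)) (h : inner ℝ x x = 1) :
    ‖x‖ = 1 := by
  have h2 : ‖x‖ ^ 2 = 1 := by rw [← real_inner_self_eq_norm_sq]; exact h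
  have h0 : 0 ≤ ‖x‖ := norm_nonneg x
  nlinarith [h2, h0]

/-- The index type of the configuration: `n` points `aᵢ`, `n` points `bᵢ`, one hub `z`. -/
abbrev Idx (n : ℕ) := Fin n ⊕ (Fin n ⊕ Unit)

/-- The `2n+1` points as coordinate vectors, given the parameters `m u v r s`:
`aᵢ = u eᵢ − ((u+v)/n) 𝟙`, `bᵢ = −s eᵢ + (m/r + s/n) 𝟙`, `z = (1/r) 𝟙`. -/
noncomputable def vec (n : ℕ) (m u v r s : ℝ) : Idx n → EuclideanSpace ℝ (Fin n)
  | Sum.inl i => toLp 2 fun k => (if k = i then u else 0) + -(u + v) / (n : ℝ)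
  | Sum.inr (Sum.inl i) => toLp 2 fun k => (if k = i then -s else 0) + (m / r + s / (n : ℝ))
  | Sum.inr (Sum.inr _) => toLp 2 fun _ => 1 / r

/-- **The configuration.**  For parameters with `u² = 1−m`, `v² = 1+(n−1)m`, `r² = n`, `s² = n(1−m²)/(n−1)`,
`u, v, r, s > 0`, `0 < m < 1/n` and `(★) u s = m(n + r v)`: the `2n+1` vectors `vec` are unit vectors with
pairwise inner products `≤ m`. -/
theorem vec_props (n : ℕ) (hn : 2 ≤ n) (m u v r s : ℝ) (hm0 : 0 < m) (hm1 : m < 1 / n)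
    (hu2 : u ^ 2 = 1 - m) (hu : 0 < u) (hv2 : v ^ 2 = 1 + ((n : ℝ) - 1) * m) (hv : 0 < v)
    (hr2 : r ^ 2 = n) (hr : 0 < r) (hs2 : s ^ 2 = (n : ℝ) * (1 - m ^ 2) / ((n : ℝ) - 1)) (hs : 0 < s)
    (hdef : u * s = m * (n + r * v)) :
    (∀ p : Idx n, inner ℝ (vec n m u v r s p) (vec n m u v r s p) = 1) ∧
      ∀ p q : Idx n, p ≠ q → inner ℝ (vec n m u v r s p) (vec n m u v r s q) ≤ m := by
  have hN : (2 : ℝ) ≤ n := by exact_mod_cast hn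
  have hN0 : (n : ℝ) ≠ 0 := by positivity
  have hN1pos : (0 : ℝ) < (n : ℝ) - 1 := by linarith
  have hN1 : ((n : ℝ) - 1) ≠ 0 := hN1pos.ne'
  have hr0 : r ≠ 0 := hr.ne'
  have hm1' : m < 1 := by
    have : 1 / (n : ℝ) ≤ 1 := by rw [div_le_one (by positivity)]; linarith
    linarith
  -- the one identity that uses (★)
  have hAB' : u * s / (n : ℝ) - v * m / r = m := by
    rw [hdef, ← hr2]
    field_simp
    ring
  -- sign facts
  have hc3 : m ^ 2 - (1 - m ^ 2) / ((n : ℝ) - 1) ≤ m := by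
    have h1 : 0 ≤ (1 - m ^ 2) / ((n : ℝ) - 1) := div_nonneg (by nlinarith) hN1pos.le
    have h2 : m ^ 2 ≤ m := by nlinarith
    linarith
  have hc2 : -v / r ≤ m := by
    have : 0 < v / r := div_pos hv hr
    rw [neg_div]
    linarith
  have hc1 : m - u * s ≤ m := by
    have : 0 < u * s := mul_pos hu hs
    linarith
  refine ⟨?_, ?_⟩
  · rintro (i | (i | z))
    · simp only [vec, EuclideanSpace.inner_toLp_toLp, dotProduct, Pi.star_apply, star_trivial]
      rw [sum_pt_pt, if_pos rfl]
      calc _ = u ^ 2 + (v ^ 2 - u ^ 2) / (n : ℝ) := by field_simp; ring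
        _ = 1 := by rw [hu2, hv2]; field_simp; ring
    · simp only [vec, EuclideanSpace.inner_toLp_toLp, dotProduct, Pi.star_apply, star_trivial]
      rw [sum_pt_pt, if_pos rfl]
      calc _ = s ^ 2 - s ^ 2 / (n : ℝ) + (n : ℝ) * m ^ 2 / r ^ 2 := by field_simp; ring
        _ = 1 := by rw [hr2, hs2]; field_simp; ring
    · simp only [vec, EuclideanSpace.inner_toLp_toLp, dotProduct, Pi.star_apply, star_trivial]
      rw [sum_const_const]
      calc _ = (n : ℝ) / r ^ 2 := by field_simp
        _ = 1 := by rw [hr2]; field_simp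
  · rintro (i | (i | z)) (j | (j | z')) hpq
    · -- ⟪a_i, a_j⟫, i ≠ j
      have hji : j ≠ i := fun h => hpq (by rw [h])
      simp only [vec, EuclideanSpace.inner_toLp_toLp, dotProduct, Pi.star_apply, star_trivial]
      rw [sum_pt_pt, if_neg hji]
      calc _ = (v ^ 2 - u ^ 2) / (n : ℝ) := by field_simp; ring
        _ = m := by rw [hu2, hv2]; field_simp; ring
        _ ≤ m := le_rfl
    · -- ⟪a_i, b_j⟫
      simp only [vec, EuclideanSpace.inner_toLp_toLp, dotProduct, Pi.star_apply, star_trivial]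
      rw [sum_pt_pt]
      by_cases hji : j = i
      · rw [if_pos hji]
        calc _ = (u * s / (n : ℝ) - v * m / r) - u * s := by field_simp; ring
          _ = m - u * s := by rw [hAB']
          _ ≤ m := hc1
      · rw [if_neg hji]
        calc _ = u * s / (n : ℝ) - v * m / r := by field_simp; ring
          _ = m := hAB'
          _ ≤ m := le_rfl
    · -- ⟪a_i, z⟫
      simp only [vec, EuclideanSpace.inner_toLp_toLp, dotProduct, Pi.star_apply, star_trivial]
      rw [sum_const_pt]
      calc _ = -v / r := by field_simp; ring
        _ ≤ m := hc2
    · -- ⟪b_i, a_j⟫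
      simp only [vec, EuclideanSpace.inner_toLp_toLp, dotProduct, Pi.star_apply, star_trivial]
      rw [sum_pt_pt]
      by_cases hji : j = i
      · rw [if_pos hji]
        calc _ = (u * s / (n : ℝ) - v * m / r) - u * s := by field_simp; ring
          _ = m - u * s := by rw [hAB']
          _ ≤ m := hc1
      · rw [if_neg hji]
        calc _ = u * s / (n : ℝ) - v * m / r := by field_simp; ring
          _ = m := hAB'
          _ ≤ m := le_rfl
    · -- ⟪b_i, b_j⟫, i ≠ j
      have hji : j ≠ i := fun h => hpq (by rw [h])
      simp only [vec, EuclideanSpace.inner_toLp_toLp, dotProduct, Pi.star_apply, star_trivial]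
      rw [sum_pt_pt, if_neg hji]
      calc _ = (n : ℝ) * m ^ 2 / r ^ 2 - s ^ 2 / (n : ℝ) := by field_simp; ring
        _ = m ^ 2 - (1 - m ^ 2) / ((n : ℝ) - 1) := by rw [hr2, hs2]; field_simp
        _ ≤ m := hc3
    · -- ⟪b_i, z⟫
      simp only [vec, EuclideanSpace.inner_toLp_toLp, dotProduct, Pi.star_apply, star_trivial]
      rw [sum_const_pt]
      calc _ = (n : ℝ) * m / r ^ 2 := by field_simp; ring
        _ = m := by rw [hr2]; field_simp
        _ ≤ m := le_rfl
    · -- ⟪z, a_j⟫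
      simp only [vec, EuclideanSpace.inner_toLp_toLp, dotProduct, Pi.star_apply, star_trivial]
      rw [sum_pt_const]
      calc _ = -v / r := by field_simp; ring
        _ ≤ m := hc2
    · -- ⟪z, b_j⟫
      simp only [vec, EuclideanSpace.inner_toLp_toLp, dotProduct, Pi.star_apply, star_trivial]
      rw [sum_pt_const]
      calc _ = (n : ℝ) * m / r ^ 2 := by field_simp; ring
        _ = m := by rw [hr2]; field_simp
        _ ≤ m := le_rfl
    · -- z ≠ z is impossible
      cases z; cases z'
      exact absurd rfl hpq

/-- **`2n+1` unit vectors in `ℝⁿ` with pairwise inner products `≤ m`** from parameters satisfying `(★)`. -/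
theorem exists_code_of_params (n : ℕ) (hn : 2 ≤ n) (m u v r s : ℝ) (hm0 : 0 < m) (hm1 : m < 1 / n)
    (hu2 : u ^ 2 = 1 - m) (hu : 0 < u) (hv2 : v ^ 2 = 1 + ((n : ℝ) - 1) * m) (hv : 0 < v)
    (hr2 : r ^ 2 = n) (hr : 0 < r) (hs2 : s ^ 2 = (n : ℝ) * (1 - m ^ 2) / ((n : ℝ) - 1)) (hs : 0 < s)
    (hdef : u * s = m * (n + r * v)) :
    ∃ C : Finset (EuclideanSpace ℝ (Fin n)), C.card = 2 * n + 1 ∧ (∀ x ∈ C, ‖x‖ = 1) ∧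
      ∀ x ∈ C, ∀ y ∈ C, x ≠ y → inner ℝ x y ≤ m := by
  classical
  obtain ⟨hnorm, hinner⟩ := vec_props n hn m u v r s hm0 hm1 hu2 hu hv2 hv hr2 hr hs2 hs hdef
  have hN : (2 : ℝ) ≤ n := by exact_mod_cast hn
  have hm1' : m < 1 := by
    have : 1 / (n : ℝ) ≤ 1 := by rw [div_le_one (by positivity)]; linarith
    linarith
  have hinj : Function.Injective (vec n m u v r s) := by
    intro p q hpq
    by_contra h
    have h1 := hinner p q h
    rw [hpq, hnorm q] at h1
    linarith
  refine ⟨Finset.univ.image (vec n m u v r s), ?_, ?_, ?_⟩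
  · rw [card_image_of_injective _ hinj, card_univ]
    simp only [Fintype.card_sum, Fintype.card_fin, Fintype.card_unit]
    omega
  · intro x hx
    obtain ⟨p, -, rfl⟩ := mem_image.1 hx
    exact norm_eq_one_of_inner n _ (hnorm p)
  · intro x hx y hy hxy
    obtain ⟨p, -, rfl⟩ := mem_image.1 hx
    obtain ⟨q, -, rfl⟩ := mem_image.1 hy
    exact hinner p q fun h => hxy (by rw [h])

/-- **The `(2n+1)`-point family (all `n ≥ 2`).**  There is `m ∈ (0, 1/n)` with `Gₙ(m) = 0`,
`Gₙ(x) = n²(n−2)² x⁴ − 4n(n−1) x³ − 2n² x² + 1`, and a set of `2n + 1` unit vectors of `ℝⁿ` whose pairwise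
inner products are all `≤ m`; i.e. `A(n, arccos m) ≥ 2n + 1`.  (`n = 2`: pentagon; `n = 3`: Schütte–van der
Waerden / Tammes `N = 7`; `n = 4, 5`: the Hardin–Smith–Sloane putative optima for `(4, 9)`, `(5, 11)`.) -/
theorem exists_code_card_two_mul_add_one (n : ℕ) (hn : 2 ≤ n) :
    ∃ m : ℝ, 0 < m ∧ m < 1 / n ∧ quartic n m = 0 ∧
      ∃ C : Finset (EuclideanSpace ℝ (Fin n)), C.card = 2 * n + 1 ∧ (∀ x ∈ C, ‖x‖ = 1) ∧
        ∀ x ∈ C, ∀ y ∈ C, x ≠ y → inner ℝ x y ≤ m := by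
  obtain ⟨m, hm0, hm1, hphi⟩ := exists_root n hn
  have hN : (2 : ℝ) ≤ n := by exact_mod_cast hn
  have hN0 : (0 : ℝ) < n := by linarith
  have hN1 : (0 : ℝ) < (n : ℝ) - 1 := by linarith
  have hm1' : m < 1 := by
    have : 1 / (n : ℝ) ≤ 1 := by rw [div_le_one hN0]; linarith
    linarith
  have h1m : (0 : ℝ) < 1 - m := by linarith
  have hvm : (0 : ℝ) < 1 + ((n : ℝ) - 1) * m := by nlinarith
  have hmm : (0 : ℝ) < 1 - m ^ 2 := by nlinarith
  have hsm : (0 : ℝ) < (n : ℝ) * (1 - m ^ 2) / ((n : ℝ) - 1) := div_pos (mul_pos hN0 hmm) hN1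
  have hu2 : sqrt (1 - m) ^ 2 = 1 - m := sq_sqrt h1m.le
  have hv2 : sqrt (1 + ((n : ℝ) - 1) * m) ^ 2 = 1 + ((n : ℝ) - 1) * m := sq_sqrt hvm.le
  have hr2 : sqrt (n : ℝ) ^ 2 = n := sq_sqrt hN0.le
  have hs2 : sqrt ((n : ℝ) * (1 - m ^ 2) / ((n : ℝ) - 1)) ^ 2 = (n : ℝ) * (1 - m ^ 2) / ((n : ℝ) - 1) :=
    sq_sqrt hsm.le
  have hdef : sqrt (1 - m) * sqrt ((n : ℝ) * (1 - m ^ 2) / ((n : ℝ) - 1))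
      = m * (n + sqrt (n : ℝ) * sqrt (1 + ((n : ℝ) - 1) * m)) := by
    unfold phi at hphi
    linarith
  exact ⟨m, hm0, hm1,
    quartic_eq_zero_of_params n hn m _ _ _ _ hm1' hu2 hv2 hr2 hs2 hdef,
    exists_code_of_params n hn m _ _ _ _ hm0 hm1 hu2 (sqrt_pos.2 h1m) hv2 (sqrt_pos.2 hvm) hr2
      (sqrt_pos.2 hN0) hs2 (sqrt_pos.2 hsm) hdef⟩

end Summit.Ventures.PackingBounds.Config.OddFamily
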